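import Summits.AtomisticToContinuum.HydrodynamicLimit.Theorems.MourreKoopmanChargesStressStrongMixingTorusStressTranslationInvariance
import Summits.AtomisticToContinuum.HydrodynamicLimit.Theorems.MourreKoopmanChargesStressStrongMixingTorusStressTrigHaar
import HarnessLib

/-!
# `StressStrongMixing` · line `birth`, stub `stub_torusStressIdentificationTrig` (helper 2/3):
# bilinearity of the torus two-time stress moment and its Schur orthogonality relations on real Fourier monomials

Support file for the crux item stmt-AtomisticToContinuum-9584 (`StressStrongMixing`, route `MourreKoopmanCharges` of
`AtomisticToContinuum/HydrodynamicLimit`), line `birth`, registered stub `stub_torusStressIdentificationTrig`.  With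
`M_N(s; χ₁, χ₂) := (N+1)·E_{G_N}[Π(χ₁)(Φ_{s(N+1)^{-1/3}} z)·Π(χ₂)(z)]`, `Π(χ)(z) = (N+1)⁻¹ Σᵢ χ(xᵢ) vᵢ⁰vᵢ¹`,
`G_N = localGibbsLaw σ 1 0 θ N (Φ N)`, and for `σ ≤ 1/2`, `θ > 0`, EVERY `N`, `s` and flow family (exact finite-`N` facts):

* `torusStressMoment_lin_left/right`, `torusStressMoment_neg_right`, `torusStressMoment_trig_lin4` — bilinearity of `M_N`
  on continuous test functions (`L²(G_N)` statics `memLp_stressField_of_continuous`, integrability of the two-time product, and the swap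
  symmetry `torusStressMoment_swap` for the second slot);
* `torusStressMoment_trig_relations` — the four averaged relations of `trigForm_average` for `B = M_N(s; ·, ·)` (translation
  invariance `torusStressMoment_posShift`);
* `torusStressMoment_trig_offResonant` — `n ≠ ±m`: all four moments `M_N(Re/Im e_n, Re/Im e_m)` vanish identically;
* `torusStressMoment_re_im`, `torusStressMoment_im_re` — the mixed moments `M_N(Re e_n, Im e_m)`, `M_N(Im e_n, Re e_m)`
  vanish for ALL `n, m` (off resonance: Schur; `m = n`: antisymmetry from averaging + symmetry from the swap; `m = −n`:
  `Im e_{−n} = −Im e_n`);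
* `torusStressMoment_im_im_eq_re_re` — isotropy `M_N(Im e_n, Im e_n) = M_N(Re e_n, Re e_n)` for `n ≠ 0`.

Consequently the only non-trivial sequences among the stub's `M_N(s; χ₁, χ₂)` are the diagonal ones `M_N(s; Re e_n, Re e_n)`
(helper 3/3 `…TorusStressTrigReduction` performs the reduction of the registered stub to this diagonal core).

References: H. Spohn, *Large Scale Dynamics of Interacting Particles* (1991), Part I §2.3, §7.1 (7.6)–(7.7), (7.14)–(7.15).
-/

noncomputable section

open MeasureTheory ProbabilityTheory Filter Topology
open scoped InnerProductSpace ENNReal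

namespace Summit.AtomisticToContinuum.HydrodynamicLimit.Theorems.MourreKoopmanChargesStressStrongMixing

open Literature.MathematicalPhysics.KineticTheory Literature.Analysis.FluidPDE

/-! ### Bilinearity of the torus two-time stress moment in the test functions -/

section Bilinear

open UnitAddTorus

variable {σ θ : ℝ}

/-- The empirical stress field is linear in the test function: `Π(αχ + βψ) = α Π(χ) + β Π(ψ)` (finite sums). [folklore] -/
theorem stressField_lin {n : ℕ} (α β : ℝ) (χ ψ : T3 → ℝ) (z : Config n (Fin 3) T3) :
    ∫ y, (α * χ y.1 + β * ψ y.1) * (y.2 0 * y.2 1) ∂(empiricalMeasure z) =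
      α * (∫ y, χ y.1 * (y.2 0 * y.2 1) ∂(empiricalMeasure z)) +
        β * (∫ y, ψ y.1 * (y.2 0 * y.2 1) ∂(empiricalMeasure z)) := by
  simp only [integral_empiricalMeasure, Finset.mul_sum, ← Finset.sum_add_distrib]
  refine Finset.sum_congr rfl fun i _ => ?_
  ring

/-- The empirical stress field of the negated test function: `Π(-χ) = -Π(χ)`. [folklore] -/
theorem stressField_neg_test {n : ℕ} (χ : T3 → ℝ) (z : Config n (Fin 3) T3) :
    ∫ y, (-χ y.1) * (y.2 0 * y.2 1) ∂(empiricalMeasure z) = -∫ y, χ y.1 * (y.2 0 * y.2 1) ∂(empiricalMeasure z) := by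
  rw [← integral_neg]
  refine integral_congr_ae (Eventually.of_forall fun y => ?_)
  simp only [neg_mul]

/-- The empirical stress field of the zero test function vanishes. [folklore] -/
theorem stressField_zero_test {n : ℕ} (z : Config n (Fin 3) T3) :
    ∫ y, (0 : ℝ) * (y.2 0 * y.2 1) ∂(empiricalMeasure z) = 0 := by
  simp only [zero_mul, integral_zero]

/-- **The empirical stress field of a continuous test function is in `L²(G_N)`** (`σ ≤ 1/2`, `θ > 0`; from the exact
statics `memLp_and_integral_stressSum_mul_stressSum`). [folklore] -/
theorem memLp_stressField_of_continuous (hσ : σ ≤ 1 / 2) (hθ : 0 < θ) (N : ℕ)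
    (Φ : HardSphereFlow (Torus.geometry (Fin 3)) (hsDiameter σ N) (N + 1)) {χ : T3 → ℝ} (hχ : Continuous χ) :
    MemLp (fun z : Config (N + 1) (Fin 3) T3 => ∫ y, χ y.1 * (y.2 0 * y.2 1) ∂(empiricalMeasure z)) 2
      (localGibbsLaw σ (fun _ => 1) (fun _ => 0) (fun _ => θ) N Φ) := by
  -- adapted from `abs_torusStressMoment_le` (TorusStatics)
  have h := ((memLp_and_integral_stressSum_mul_stressSum hσ hθ N Φ hχ hχ).1).const_mul (((N + 1 : ℕ) : ℝ))⁻¹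
  refine h.congr_norm (measurable_stressField hχ).aestronglyMeasurable (Eventually.of_forall fun z => ?_)
  rw [stressField_eq_sum χ z]

/-- **The two-time product of two empirical stress fields is `G_N`-integrable** (`σ ≤ 1/2`, `θ > 0`, continuous test
functions; Cauchy–Schwarz with the invariance of `G_N` under the flow). [folklore] -/
theorem integrable_stressField_flow_mul_of_continuous (hσ : σ ≤ 1 / 2) (hθ : 0 < θ) (N : ℕ)
    (Φ : HardSphereFlow (Torus.geometry (Fin 3)) (hsDiameter σ N) (N + 1)) {χ₁ χ₂ : T3 → ℝ}
    (hχ₁ : Continuous χ₁) (hχ₂ : Continuous χ₂) (t : ℝ) :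
    Integrable (fun z : Config (N + 1) (Fin 3) T3 =>
        (∫ y, χ₁ y.1 * (y.2 0 * y.2 1) ∂(empiricalMeasure (Φ.flow t z))) *
          (∫ y, χ₂ y.1 * (y.2 0 * y.2 1) ∂(empiricalMeasure z)))
      (localGibbsLaw σ (fun _ => 1) (fun _ => 0) (fun _ => θ) N Φ) :=
  ((memLp_stressField_of_continuous hσ hθ N Φ hχ₁).comp_measurePreserving
    (measurePreserving_flow_localGibbsLaw_const σ 1 θ 0 N Φ t)).integrable_mul (memLp_stressField_of_continuous hσ hθ N Φ hχ₂)

/-- **Linearity of the torus two-time stress moment in the first test function** (`σ ≤ 1/2`, `θ > 0`, continuous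
test functions): `M_N(s; αχ + βψ, χ₂) = α M_N(s; χ, χ₂) + β M_N(s; ψ, χ₂)`. [folklore] -/
theorem torusStressMoment_lin_left (hσ : σ ≤ 1 / 2) (hθ : 0 < θ)
    (Φ : (N : ℕ) → HardSphereFlow (Torus.geometry (Fin 3)) (hsDiameter σ N) (N + 1))
    {χ ψ χ₂ : T3 → ℝ} (hχ : Continuous χ) (hψ : Continuous ψ) (hχ₂ : Continuous χ₂) (α β s : ℝ) (N : ℕ) :
    ((N : ℝ) + 1) * ∫ z, (∫ y, (α * χ y.1 + β * ψ y.1) * (y.2 0 * y.2 1)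
        ∂(empiricalMeasure ((Φ N).flow (s * ((N : ℝ) + 1) ^ (-(1 / 3 : ℝ))) z))) *
      (∫ y, χ₂ y.1 * (y.2 0 * y.2 1) ∂(empiricalMeasure z))
      ∂(localGibbsLaw σ (fun _ => 1) (fun _ => 0) (fun _ => θ) N (Φ N)) =
    α * (((N : ℝ) + 1) * ∫ z, (∫ y, χ y.1 * (y.2 0 * y.2 1)
        ∂(empiricalMeasure ((Φ N).flow (s * ((N : ℝ) + 1) ^ (-(1 / 3 : ℝ))) z))) *
      (∫ y, χ₂ y.1 * (y.2 0 * y.2 1) ∂(empiricalMeasure z))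
      ∂(localGibbsLaw σ (fun _ => 1) (fun _ => 0) (fun _ => θ) N (Φ N))) +
    β * (((N : ℝ) + 1) * ∫ z, (∫ y, ψ y.1 * (y.2 0 * y.2 1)
        ∂(empiricalMeasure ((Φ N).flow (s * ((N : ℝ) + 1) ^ (-(1 / 3 : ℝ))) z))) *
      (∫ y, χ₂ y.1 * (y.2 0 * y.2 1) ∂(empiricalMeasure z))
      ∂(localGibbsLaw σ (fun _ => 1) (fun _ => 0) (fun _ => θ) N (Φ N))) := by
  set t : ℝ := s * ((N : ℝ) + 1) ^ (-(1 / 3 : ℝ)) with ht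
  have i1 := integrable_stressField_flow_mul_of_continuous hσ hθ N (Φ N) hχ hχ₂ t
  have i2 := integrable_stressField_flow_mul_of_continuous hσ hθ N (Φ N) hψ hχ₂ t
  have step : ∫ z, (∫ y, (α * χ y.1 + β * ψ y.1) * (y.2 0 * y.2 1) ∂(empiricalMeasure ((Φ N).flow t z))) *
      (∫ y, χ₂ y.1 * (y.2 0 * y.2 1) ∂(empiricalMeasure z))
      ∂(localGibbsLaw σ (fun _ => 1) (fun _ => 0) (fun _ => θ) N (Φ N)) =
      ∫ z, (α * ((∫ y, χ y.1 * (y.2 0 * y.2 1) ∂(empiricalMeasure ((Φ N).flow t z))) *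
          (∫ y, χ₂ y.1 * (y.2 0 * y.2 1) ∂(empiricalMeasure z))) +
        β * ((∫ y, ψ y.1 * (y.2 0 * y.2 1) ∂(empiricalMeasure ((Φ N).flow t z))) *
          (∫ y, χ₂ y.1 * (y.2 0 * y.2 1) ∂(empiricalMeasure z))))
      ∂(localGibbsLaw σ (fun _ => 1) (fun _ => 0) (fun _ => θ) N (Φ N)) := by
    refine integral_congr_ae (Eventually.of_forall fun z => ?_)
    simp only [stressField_lin]
    ring
  rw [step, integral_add (i1.const_mul α) (i2.const_mul β), integral_const_mul, integral_const_mul]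
  ring

/-- **Linearity of the torus two-time stress moment in the second test function** (by the swap symmetry
`torusStressMoment_swap` and `torusStressMoment_lin_left`). [folklore] -/
theorem torusStressMoment_lin_right (hσ : σ ≤ 1 / 2) (hθ : 0 < θ)
    (Φ : (N : ℕ) → HardSphereFlow (Torus.geometry (Fin 3)) (hsDiameter σ N) (N + 1))
    {χ₁ χ ψ : T3 → ℝ} (hχ₁ : Continuous χ₁) (hχ : Continuous χ) (hψ : Continuous ψ) (α β s : ℝ) (N : ℕ) :
    ((N : ℝ) + 1) * ∫ z, (∫ y, χ₁ y.1 * (y.2 0 * y.2 1)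
        ∂(empiricalMeasure ((Φ N).flow (s * ((N : ℝ) + 1) ^ (-(1 / 3 : ℝ))) z))) *
      (∫ y, (α * χ y.1 + β * ψ y.1) * (y.2 0 * y.2 1) ∂(empiricalMeasure z))
      ∂(localGibbsLaw σ (fun _ => 1) (fun _ => 0) (fun _ => θ) N (Φ N)) =
    α * (((N : ℝ) + 1) * ∫ z, (∫ y, χ₁ y.1 * (y.2 0 * y.2 1)
        ∂(empiricalMeasure ((Φ N).flow (s * ((N : ℝ) + 1) ^ (-(1 / 3 : ℝ))) z))) *
      (∫ y, χ y.1 * (y.2 0 * y.2 1) ∂(empiricalMeasure z))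
      ∂(localGibbsLaw σ (fun _ => 1) (fun _ => 0) (fun _ => θ) N (Φ N))) +
    β * (((N : ℝ) + 1) * ∫ z, (∫ y, χ₁ y.1 * (y.2 0 * y.2 1)
        ∂(empiricalMeasure ((Φ N).flow (s * ((N : ℝ) + 1) ^ (-(1 / 3 : ℝ))) z))) *
      (∫ y, ψ y.1 * (y.2 0 * y.2 1) ∂(empiricalMeasure z))
      ∂(localGibbsLaw σ (fun _ => 1) (fun _ => 0) (fun _ => θ) N (Φ N))) := by
  have hlin : Continuous fun x : T3 => α * χ x + β * ψ x := by fun_prop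
  have h1 := torusStressMoment_swap σ θ Φ hχ₁ hlin s N
  have h2 := torusStressMoment_lin_left hσ hθ Φ hχ hψ hχ₁ α β s N
  have h3 := torusStressMoment_swap σ θ Φ hχ hχ₁ s N
  have h4 := torusStressMoment_swap σ θ Φ hψ hχ₁ s N
  rw [h1, h2, h3, h4]

/-- **Negating the second test function negates the moment** (no hypotheses). [folklore] -/
theorem torusStressMoment_neg_right (σ θ : ℝ)
    (Φ : (N : ℕ) → HardSphereFlow (Torus.geometry (Fin 3)) (hsDiameter σ N) (N + 1))
    (χ₁ χ₂ : T3 → ℝ) (s : ℝ) (N : ℕ) :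
    ((N : ℝ) + 1) * ∫ z, (∫ y, χ₁ y.1 * (y.2 0 * y.2 1)
        ∂(empiricalMeasure ((Φ N).flow (s * ((N : ℝ) + 1) ^ (-(1 / 3 : ℝ))) z))) *
      (∫ y, (-χ₂ y.1) * (y.2 0 * y.2 1) ∂(empiricalMeasure z))
      ∂(localGibbsLaw σ (fun _ => 1) (fun _ => 0) (fun _ => θ) N (Φ N)) =
    -(((N : ℝ) + 1) * ∫ z, (∫ y, χ₁ y.1 * (y.2 0 * y.2 1)
        ∂(empiricalMeasure ((Φ N).flow (s * ((N : ℝ) + 1) ^ (-(1 / 3 : ℝ))) z))) *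
      (∫ y, χ₂ y.1 * (y.2 0 * y.2 1) ∂(empiricalMeasure z))
      ∂(localGibbsLaw σ (fun _ => 1) (fun _ => 0) (fun _ => θ) N (Φ N))) := by
  rw [← mul_neg, ← integral_neg]
  congr 1
  refine integral_congr_ae (Eventually.of_forall fun z => ?_)
  simp only [stressField_neg_test, mul_neg]

/-- **The four-term expansion on real Fourier monomials**:
`M_N(s; α Re e_n + β Im e_n, γ Re e_m + δ Im e_m) = αγ M_cc + αδ M_cs + βγ M_sc + βδ M_ss`. [folklore] -/
theorem torusStressMoment_trig_lin4 (hσ : σ ≤ 1 / 2) (hθ : 0 < θ)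
    (Φ : (N : ℕ) → HardSphereFlow (Torus.geometry (Fin 3)) (hsDiameter σ N) (N + 1))
    (n m : Fin 3 → ℤ) (s : ℝ) (N : ℕ) (α β γ δ : ℝ) :
    ((N : ℝ) + 1) * ∫ z, (∫ y, (α * (mFourier n y.1).re + β * (mFourier n y.1).im) * (y.2 0 * y.2 1)
        ∂(empiricalMeasure ((Φ N).flow (s * ((N : ℝ) + 1) ^ (-(1 / 3 : ℝ))) z))) *
      (∫ y, (γ * (mFourier m y.1).re + δ * (mFourier m y.1).im) * (y.2 0 * y.2 1) ∂(empiricalMeasure z))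
      ∂(localGibbsLaw σ (fun _ => 1) (fun _ => 0) (fun _ => θ) N (Φ N)) =
    α * γ * (((N : ℝ) + 1) * ∫ z, (∫ y, (mFourier n y.1).re * (y.2 0 * y.2 1)
        ∂(empiricalMeasure ((Φ N).flow (s * ((N : ℝ) + 1) ^ (-(1 / 3 : ℝ))) z))) *
      (∫ y, (mFourier m y.1).re * (y.2 0 * y.2 1) ∂(empiricalMeasure z))
      ∂(localGibbsLaw σ (fun _ => 1) (fun _ => 0) (fun _ => θ) N (Φ N))) +
    α * δ * (((N : ℝ) + 1) * ∫ z, (∫ y, (mFourier n y.1).re * (y.2 0 * y.2 1)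
        ∂(empiricalMeasure ((Φ N).flow (s * ((N : ℝ) + 1) ^ (-(1 / 3 : ℝ))) z))) *
      (∫ y, (mFourier m y.1).im * (y.2 0 * y.2 1) ∂(empiricalMeasure z))
      ∂(localGibbsLaw σ (fun _ => 1) (fun _ => 0) (fun _ => θ) N (Φ N))) +
    β * γ * (((N : ℝ) + 1) * ∫ z, (∫ y, (mFourier n y.1).im * (y.2 0 * y.2 1)
        ∂(empiricalMeasure ((Φ N).flow (s * ((N : ℝ) + 1) ^ (-(1 / 3 : ℝ))) z))) *
      (∫ y, (mFourier m y.1).re * (y.2 0 * y.2 1) ∂(empiricalMeasure z))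
      ∂(localGibbsLaw σ (fun _ => 1) (fun _ => 0) (fun _ => θ) N (Φ N))) +
    β * δ * (((N : ℝ) + 1) * ∫ z, (∫ y, (mFourier n y.1).im * (y.2 0 * y.2 1)
        ∂(empiricalMeasure ((Φ N).flow (s * ((N : ℝ) + 1) ^ (-(1 / 3 : ℝ))) z))) *
      (∫ y, (mFourier m y.1).im * (y.2 0 * y.2 1) ∂(empiricalMeasure z))
      ∂(localGibbsLaw σ (fun _ => 1) (fun _ => 0) (fun _ => θ) N (Φ N))) := by
  have hlin : Continuous fun x : T3 => γ * (mFourier m x).re + δ * (mFourier m x).im := by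
    have := continuous_re_mFourier m
    have := continuous_im_mFourier m
    fun_prop
  rw [torusStressMoment_lin_left hσ hθ Φ (continuous_re_mFourier n) (continuous_im_mFourier n) hlin α β s N,
    torusStressMoment_lin_right hσ hθ Φ (continuous_re_mFourier n) (continuous_re_mFourier m) (continuous_im_mFourier m)
      γ δ s N,
    torusStressMoment_lin_right hσ hθ Φ (continuous_im_mFourier n) (continuous_re_mFourier m) (continuous_im_mFourier m)
      γ δ s N]
  ring

end Bilinear

/-! ### Schur orthogonality relations for the torus stress moment on real Fourier monomials -/

section Schur

open UnitAddTorus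

variable {σ θ : ℝ}

/-- **The four averaged relations for the torus stress moment** (`σ ≤ 1/2`, `θ > 0`, every `N`, `s`, flow family,
wavenumbers `n, m`): the abstract averaging lemma `trigForm_average` applied to `B(χ₁, χ₂) := M_N(s; χ₁, χ₂)`, which is
translation invariant (`torusStressMoment_posShift`) and bilinear on trigonometric polynomials
(`torusStressMoment_trig_lin4`). [folklore] -/
theorem torusStressMoment_trig_relations (hσ : σ ≤ 1 / 2) (hθ : 0 < θ)
    (Φ : (N : ℕ) → HardSphereFlow (Torus.geometry (Fin 3)) (hsDiameter σ N) (N + 1))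
    (n m : Fin 3 → ℤ) (s : ℝ) (N : ℕ) :
    ((((N : ℝ) + 1) * ∫ z, (∫ y, (mFourier n y.1).re * (y.2 0 * y.2 1)
        ∂(empiricalMeasure ((Φ N).flow (s * ((N : ℝ) + 1) ^ (-(1 / 3 : ℝ))) z))) *
      (∫ y, (mFourier m y.1).re * (y.2 0 * y.2 1) ∂(empiricalMeasure z))
      ∂(localGibbsLaw σ (fun _ => 1) (fun _ => 0) (fun _ => θ) N (Φ N))) =
      (∫ a : T3, (mFourier n a).re * (mFourier m a).re) * (((N : ℝ) + 1) * ∫ z, (∫ y, (mFourier n y.1).re * (y.2 0 * y.2 1)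
        ∂(empiricalMeasure ((Φ N).flow (s * ((N : ℝ) + 1) ^ (-(1 / 3 : ℝ))) z))) *
      (∫ y, (mFourier m y.1).re * (y.2 0 * y.2 1) ∂(empiricalMeasure z))
      ∂(localGibbsLaw σ (fun _ => 1) (fun _ => 0) (fun _ => θ) N (Φ N))) +
      (∫ a : T3, (mFourier n a).im * (mFourier m a).im) * (((N : ℝ) + 1) * ∫ z, (∫ y, (mFourier n y.1).im * (y.2 0 * y.2 1)
        ∂(empiricalMeasure ((Φ N).flow (s * ((N : ℝ) + 1) ^ (-(1 / 3 : ℝ))) z))) *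
      (∫ y, (mFourier m y.1).im * (y.2 0 * y.2 1) ∂(empiricalMeasure z))
      ∂(localGibbsLaw σ (fun _ => 1) (fun _ => 0) (fun _ => θ) N (Φ N)))) ∧
    ((((N : ℝ) + 1) * ∫ z, (∫ y, (mFourier n y.1).re * (y.2 0 * y.2 1)
        ∂(empiricalMeasure ((Φ N).flow (s * ((N : ℝ) + 1) ^ (-(1 / 3 : ℝ))) z))) *
      (∫ y, (mFourier m y.1).im * (y.2 0 * y.2 1) ∂(empiricalMeasure z))
      ∂(localGibbsLaw σ (fun _ => 1) (fun _ => 0) (fun _ => θ) N (Φ N))) =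
      (∫ a : T3, (mFourier n a).re * (mFourier m a).re) * (((N : ℝ) + 1) * ∫ z, (∫ y, (mFourier n y.1).re * (y.2 0 * y.2 1)
        ∂(empiricalMeasure ((Φ N).flow (s * ((N : ℝ) + 1) ^ (-(1 / 3 : ℝ))) z))) *
      (∫ y, (mFourier m y.1).im * (y.2 0 * y.2 1) ∂(empiricalMeasure z))
      ∂(localGibbsLaw σ (fun _ => 1) (fun _ => 0) (fun _ => θ) N (Φ N))) -
      (∫ a : T3, (mFourier n a).im * (mFourier m a).im) * (((N : ℝ) + 1) * ∫ z, (∫ y, (mFourier n y.1).im * (y.2 0 * y.2 1)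
        ∂(empiricalMeasure ((Φ N).flow (s * ((N : ℝ) + 1) ^ (-(1 / 3 : ℝ))) z))) *
      (∫ y, (mFourier m y.1).re * (y.2 0 * y.2 1) ∂(empiricalMeasure z))
      ∂(localGibbsLaw σ (fun _ => 1) (fun _ => 0) (fun _ => θ) N (Φ N)))) ∧
    ((((N : ℝ) + 1) * ∫ z, (∫ y, (mFourier n y.1).im * (y.2 0 * y.2 1)
        ∂(empiricalMeasure ((Φ N).flow (s * ((N : ℝ) + 1) ^ (-(1 / 3 : ℝ))) z))) *
      (∫ y, (mFourier m y.1).re * (y.2 0 * y.2 1) ∂(empiricalMeasure z))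
      ∂(localGibbsLaw σ (fun _ => 1) (fun _ => 0) (fun _ => θ) N (Φ N))) =
      (∫ a : T3, (mFourier n a).re * (mFourier m a).re) * (((N : ℝ) + 1) * ∫ z, (∫ y, (mFourier n y.1).im * (y.2 0 * y.2 1)
        ∂(empiricalMeasure ((Φ N).flow (s * ((N : ℝ) + 1) ^ (-(1 / 3 : ℝ))) z))) *
      (∫ y, (mFourier m y.1).re * (y.2 0 * y.2 1) ∂(empiricalMeasure z))
      ∂(localGibbsLaw σ (fun _ => 1) (fun _ => 0) (fun _ => θ) N (Φ N))) -
      (∫ a : T3, (mFourier n a).im * (mFourier m a).im) * (((N : ℝ) + 1) * ∫ z, (∫ y, (mFourier n y.1).re * (y.2 0 * y.2 1)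
        ∂(empiricalMeasure ((Φ N).flow (s * ((N : ℝ) + 1) ^ (-(1 / 3 : ℝ))) z))) *
      (∫ y, (mFourier m y.1).im * (y.2 0 * y.2 1) ∂(empiricalMeasure z))
      ∂(localGibbsLaw σ (fun _ => 1) (fun _ => 0) (fun _ => θ) N (Φ N)))) ∧
    ((((N : ℝ) + 1) * ∫ z, (∫ y, (mFourier n y.1).im * (y.2 0 * y.2 1)
        ∂(empiricalMeasure ((Φ N).flow (s * ((N : ℝ) + 1) ^ (-(1 / 3 : ℝ))) z))) *
      (∫ y, (mFourier m y.1).im * (y.2 0 * y.2 1) ∂(empiricalMeasure z))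
      ∂(localGibbsLaw σ (fun _ => 1) (fun _ => 0) (fun _ => θ) N (Φ N))) =
      (∫ a : T3, (mFourier n a).im * (mFourier m a).im) * (((N : ℝ) + 1) * ∫ z, (∫ y, (mFourier n y.1).re * (y.2 0 * y.2 1)
        ∂(empiricalMeasure ((Φ N).flow (s * ((N : ℝ) + 1) ^ (-(1 / 3 : ℝ))) z))) *
      (∫ y, (mFourier m y.1).re * (y.2 0 * y.2 1) ∂(empiricalMeasure z))
      ∂(localGibbsLaw σ (fun _ => 1) (fun _ => 0) (fun _ => θ) N (Φ N))) +
      (∫ a : T3, (mFourier n a).re * (mFourier m a).re) * (((N : ℝ) + 1) * ∫ z, (∫ y, (mFourier n y.1).im * (y.2 0 * y.2 1)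
        ∂(empiricalMeasure ((Φ N).flow (s * ((N : ℝ) + 1) ^ (-(1 / 3 : ℝ))) z))) *
      (∫ y, (mFourier m y.1).im * (y.2 0 * y.2 1) ∂(empiricalMeasure z))
      ∂(localGibbsLaw σ (fun _ => 1) (fun _ => 0) (fun _ => θ) N (Φ N)))) :=
  trigForm_average (B := fun χ₁ χ₂ : T3 → ℝ => ((N : ℝ) + 1) * ∫ z, (∫ y, χ₁ y.1 * (y.2 0 * y.2 1)
        ∂(empiricalMeasure ((Φ N).flow (s * ((N : ℝ) + 1) ^ (-(1 / 3 : ℝ))) z))) *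
      (∫ y, χ₂ y.1 * (y.2 0 * y.2 1) ∂(empiricalMeasure z))
      ∂(localGibbsLaw σ (fun _ => 1) (fun _ => 0) (fun _ => θ) N (Φ N))) n m
    (fun a χ₁ χ₂ => torusStressMoment_posShift σ θ Φ χ₁ χ₂ s N a)
    (fun α β γ δ => torusStressMoment_trig_lin4 hσ hθ Φ n m s N α β γ δ)

/-- **Off-resonant wavenumbers: all four moments vanish identically** (`n ≠ m`, `n ≠ -m`; every `N`). [folklore] -/
theorem torusStressMoment_trig_offResonant (hσ : σ ≤ 1 / 2) (hθ : 0 < θ)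
    (Φ : (N : ℕ) → HardSphereFlow (Torus.geometry (Fin 3)) (hsDiameter σ N) (N + 1))
    {n m : Fin 3 → ℤ} (hp : n + m ≠ 0) (hm : n - m ≠ 0) (s : ℝ) (N : ℕ) :
    (((N : ℝ) + 1) * ∫ z, (∫ y, (mFourier n y.1).re * (y.2 0 * y.2 1)
        ∂(empiricalMeasure ((Φ N).flow (s * ((N : ℝ) + 1) ^ (-(1 / 3 : ℝ))) z))) *
      (∫ y, (mFourier m y.1).re * (y.2 0 * y.2 1) ∂(empiricalMeasure z))
      ∂(localGibbsLaw σ (fun _ => 1) (fun _ => 0) (fun _ => θ) N (Φ N))) = 0 ∧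
    (((N : ℝ) + 1) * ∫ z, (∫ y, (mFourier n y.1).re * (y.2 0 * y.2 1)
        ∂(empiricalMeasure ((Φ N).flow (s * ((N : ℝ) + 1) ^ (-(1 / 3 : ℝ))) z))) *
      (∫ y, (mFourier m y.1).im * (y.2 0 * y.2 1) ∂(empiricalMeasure z))
      ∂(localGibbsLaw σ (fun _ => 1) (fun _ => 0) (fun _ => θ) N (Φ N))) = 0 ∧
    (((N : ℝ) + 1) * ∫ z, (∫ y, (mFourier n y.1).im * (y.2 0 * y.2 1)
        ∂(empiricalMeasure ((Φ N).flow (s * ((N : ℝ) + 1) ^ (-(1 / 3 : ℝ))) z))) *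
      (∫ y, (mFourier m y.1).re * (y.2 0 * y.2 1) ∂(empiricalMeasure z))
      ∂(localGibbsLaw σ (fun _ => 1) (fun _ => 0) (fun _ => θ) N (Φ N))) = 0 ∧
    (((N : ℝ) + 1) * ∫ z, (∫ y, (mFourier n y.1).im * (y.2 0 * y.2 1)
        ∂(empiricalMeasure ((Φ N).flow (s * ((N : ℝ) + 1) ^ (-(1 / 3 : ℝ))) z))) *
      (∫ y, (mFourier m y.1).im * (y.2 0 * y.2 1) ∂(empiricalMeasure z))
      ∂(localGibbsLaw σ (fun _ => 1) (fun _ => 0) (fun _ => θ) N (Φ N))) = 0 := by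
  obtain ⟨h1, h2, h3, h4⟩ := torusStressMoment_trig_relations hσ hθ Φ n m s N
  rw [integral_re_mul_re_mFourier, integral_im_mul_im_mFourier, if_neg hp, if_neg hm] at h1 h2 h3 h4
  exact ⟨by linarith [h1], by linarith [h2], by linarith [h3], by linarith [h4]⟩

/-- **The mixed moment `M_N(s; Re e_n, Im e_m)` vanishes for all wavenumbers** (off-resonant: Schur; `m = n`: the averaged
relation gives antisymmetry, the swap symmetry gives symmetry; `m = -n`: `Im e_{-n} = -Im e_n`). [folklore] -/
theorem torusStressMoment_re_im (hσ : σ ≤ 1 / 2) (hθ : 0 < θ)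
    (Φ : (N : ℕ) → HardSphereFlow (Torus.geometry (Fin 3)) (hsDiameter σ N) (N + 1))
    (n m : Fin 3 → ℤ) (s : ℝ) (N : ℕ) :
    ((N : ℝ) + 1) * ∫ z, (∫ y, (mFourier n y.1).re * (y.2 0 * y.2 1)
        ∂(empiricalMeasure ((Φ N).flow (s * ((N : ℝ) + 1) ^ (-(1 / 3 : ℝ))) z))) *
      (∫ y, (mFourier m y.1).im * (y.2 0 * y.2 1) ∂(empiricalMeasure z))
      ∂(localGibbsLaw σ (fun _ => 1) (fun _ => 0) (fun _ => θ) N (Φ N)) = 0 := by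
  -- the case `m = n`
  have hdiag : ∀ k : Fin 3 → ℤ, (((N : ℝ) + 1) * ∫ z, (∫ y, (mFourier k y.1).re * (y.2 0 * y.2 1)
        ∂(empiricalMeasure ((Φ N).flow (s * ((N : ℝ) + 1) ^ (-(1 / 3 : ℝ))) z))) *
      (∫ y, (mFourier k y.1).im * (y.2 0 * y.2 1) ∂(empiricalMeasure z))
      ∂(localGibbsLaw σ (fun _ => 1) (fun _ => 0) (fun _ => θ) N (Φ N))) = 0 := by
    intro k
    by_cases hk : k = 0
    · subst hk
      have h0 : (fun x : T3 => (mFourier (0 : Fin 3 → ℤ) x).im) = fun _ => 0 := by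
        funext x; simp [mFourier_zero]
      simp only [mFourier_zero, ContinuousMap.one_apply, Complex.one_im, zero_mul, integral_zero, mul_zero,
        integral_zero]
    · obtain ⟨-, h2, -, -⟩ := torusStressMoment_trig_relations hσ hθ Φ k k s N
      have hkk : k + k ≠ 0 := fun h => hk (by
        funext i; have := congrFun h i; simp only [Pi.add_apply, Pi.zero_apply] at this ⊢; omega)
      rw [integral_re_mul_re_mFourier, integral_im_mul_im_mFourier, if_neg hkk, sub_self, if_pos rfl] at h2
      have hsw := torusStressMoment_swap σ θ Φ (continuous_re_mFourier k) (continuous_im_mFourier k) s N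
      norm_num at h2
      linarith
  by_cases hm : n - m = 0
  · obtain rfl : n = m := sub_eq_zero.1 hm
    exact hdiag n
  by_cases hp : n + m = 0
  · have hmn : m = -n := (neg_eq_of_add_eq_zero_right hp).symm
    subst hmn
    have hfun : ∀ y : T3 × V3, (mFourier (-n) y.1).im = -(mFourier n y.1).im := fun y => by
      rw [mFourier_neg, Complex.conj_im]
    simp_rw [hfun]
    rw [torusStressMoment_neg_right σ θ Φ (fun x => (mFourier n x).re) (fun x => (mFourier n x).im) s N, hdiag n,
      neg_zero]
  exact (torusStressMoment_trig_offResonant hσ hθ Φ hp hm s N).2.1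

/-- **The mixed moment `M_N(s; Im e_n, Re e_m)` vanishes for all wavenumbers** (swap symmetry and
`torusStressMoment_re_im`). [folklore] -/
theorem torusStressMoment_im_re (hσ : σ ≤ 1 / 2) (hθ : 0 < θ)
    (Φ : (N : ℕ) → HardSphereFlow (Torus.geometry (Fin 3)) (hsDiameter σ N) (N + 1))
    (n m : Fin 3 → ℤ) (s : ℝ) (N : ℕ) :
    ((N : ℝ) + 1) * ∫ z, (∫ y, (mFourier n y.1).im * (y.2 0 * y.2 1)
        ∂(empiricalMeasure ((Φ N).flow (s * ((N : ℝ) + 1) ^ (-(1 / 3 : ℝ))) z))) *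
      (∫ y, (mFourier m y.1).re * (y.2 0 * y.2 1) ∂(empiricalMeasure z))
      ∂(localGibbsLaw σ (fun _ => 1) (fun _ => 0) (fun _ => θ) N (Φ N)) = 0 := by
  rw [torusStressMoment_swap σ θ Φ (continuous_im_mFourier n) (continuous_re_mFourier m) s N]
  exact torusStressMoment_re_im hσ hθ Φ m n s N

/-- **Diagonal isotropy: `M_N(s; Im e_n, Im e_n) = M_N(s; Re e_n, Re e_n)` for `n ≠ 0`** (the averaged relation
`M_cc = ½ M_cc + ½ M_ss`). [folklore] -/
theorem torusStressMoment_im_im_eq_re_re :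
    ∀ {σ θ : ℝ}, σ ≤ 1 / 2 → 0 < θ →
    ∀ (Φ : (N : ℕ) → HardSphereFlow (Torus.geometry (Fin 3)) (hsDiameter σ N) (N + 1))
      {n : Fin 3 → ℤ}, n ≠ 0 → ∀ (s : ℝ) (N : ℕ),
    ((N : ℝ) + 1) * ∫ z, (∫ y, (UnitAddTorus.mFourier n y.1).im * (y.2 0 * y.2 1)
        ∂(empiricalMeasure ((Φ N).flow (s * ((N : ℝ) + 1) ^ (-(1 / 3 : ℝ))) z))) *
      (∫ y, (UnitAddTorus.mFourier n y.1).im * (y.2 0 * y.2 1) ∂(empiricalMeasure z))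
      ∂(localGibbsLaw σ (fun _ => 1) (fun _ => 0) (fun _ => θ) N (Φ N)) =
    ((N : ℝ) + 1) * ∫ z, (∫ y, (UnitAddTorus.mFourier n y.1).re * (y.2 0 * y.2 1)
        ∂(empiricalMeasure ((Φ N).flow (s * ((N : ℝ) + 1) ^ (-(1 / 3 : ℝ))) z))) *
      (∫ y, (UnitAddTorus.mFourier n y.1).re * (y.2 0 * y.2 1) ∂(empiricalMeasure z))
      ∂(localGibbsLaw σ (fun _ => 1) (fun _ => 0) (fun _ => θ) N (Φ N)) := by
  intro σ θ hσ hθ Φ n hn s N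
  obtain ⟨h1, -, -, -⟩ := torusStressMoment_trig_relations hσ hθ Φ n n s N
  have hnn : n + n ≠ 0 := fun h => hn (by
    funext i; have := congrFun h i; simp only [Pi.add_apply, Pi.zero_apply] at this ⊢; omega)
  rw [integral_re_mul_re_mFourier, integral_im_mul_im_mFourier, if_neg hnn, sub_self, if_pos rfl] at h1
  norm_num at h1
  linarith

end Schur

end Summit.AtomisticToContinuum.HydrodynamicLimit.Theorems.MourreKoopmanChargesStressStrongMixing

end
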